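import Summits.Ventures.HSemireg.WedgeHankelRecurrenceGaussChebyshevTLevelSetUniformReal

/-!
# Venture HSemireg — **`C_n' = n S_{n−1}`, `C_n'(2) = n²`, AND THE SINE PRODUCT: `∏_{j=1}^{n−1} (2 − 2cos(2πj∕n)) = n²`, `∏_{j=1}^{n−1} sin(πj∕n) = n ∕ 2^{n−1}`** (`n ≥ 1`) — by differentiating
# the uniform factorisation `C_n − 2 = (X − 2) ∏_{j=1}^{n−1} (X − 2cos(2πj∕n))` of N508 at `X = 2`

HONEST FRAMING. Part of the Lean index of the computation cell `pub-hsemireg` (seat p10 gen 49, Sunday typer «UNIFORM-IN-n»).  Real polynomial algebra and trigonometry only (Mathlib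
`Polynomial.Chebyshev.C ∕ S`, `Polynomial.derivative`, `Real.sin ∕ cos`); no variety, no cohomology theory, no sheaf, no Ext group and no semiregularity map is constructed here; nothing here says
that HC / HC_CM / HC_AV holds; no Literature fact (unproved `Prop`) is declared or used.  Custodian versions as in `WedgeHankelSiegelIdeal` (1/3).
SOURCES (cited).  T. J. Rivlin, *The Chebyshev Polynomials* (1974), §1.2, (1.97) (`T_n'(1) = n²`) and Ex. 1.5.x; I. S. Gradshteyn, I. M. Ryzhik, *Table of Integrals, Series, and Products*, 1.392.1
(`∏_{k=1}^{n−1} sin(kπ∕n) = n∕2^{n−1}`); J. C. Mason, D. C. Handscomb, *Chebyshev Polynomials* (2003), §2.4.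
PROOF TYPED HERE.  `C_n' = n S_{n−1}` by the two-step induction of Mathlib `T_derivative_eq_U` (relations `C_{n+2} = X C_{n+1} − C_n`, `C_n = 2S_n − X S_{n−1}`, `S_{n−1} = X S_n − S_{n+1}`);
`C_n'(2) = n · S_{n−1}(2) = n²` (Mathlib `S_eval_two`); split `j = 0` off N508's product and differentiate `(X − 2)·Q` at `2` (`derivative_mul`, `eval`): `Q(2) = n²`; finally `2 − 2cos 2θ = 4sin² θ`
and positivity of `sin(πj∕n)` (`0 < j < n`) extract the square root.
DEDUP DISCLOSURE (`rg -n 'derivative .Polynomial.Chebyshev.C|prod_sin|sin_pi_div' Summits Literature`, `lean search`, 2026-09-04): Mathlib has `T_derivative_eq_U`, `derivative_T_eval_one`,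
`derivative_U_eval_one`, and Euler's infinite sine product (`tendsto_euler_sin_prod`), but neither `C_n'` nor the finite sine product; the tree has neither; 0 hits for the 6 names below.

WHAT IS IN THE TREE.  N508 `chebyshevC_sub_two_eq_prod_cos_real`; Mathlib `S_eval_two`, `C_add_two ∕ C_sub_one`, `S_sub_one ∕ S_sub_two`, `C_eq_S_sub_X_mul_S`, `derivative_mul`, `Real.cos_sq`/`sin_sq`.
THIS FILE (namespace `Summit.Ventures.HSemireg.Wedge.HankelOuter` continued; CHAINED on N509; 0 definitions):
* §1275 **`chebyshevC_derivative_eq_S`** (`C_n' = n S_{n−1}`, all `n ∈ ℤ`, every commutative ring), **`chebyshevC_derivative_eval_two`** (`C_n'(2) = n²`), **`prod_two_sub_two_mul_cos_eq_sq`**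
  (`∏_{j=1}^{n−1} (2 − 2cos(2πj∕n)) = n²`), `prod_four_mul_sin_sq_eq_sq` (`∏ 4sin²(πj∕n) = n²`), **`prod_two_mul_sin_eq`** (`∏_{j=1}^{n−1} 2sin(πj∕n) = n`), **`prod_sin_pi_div_eq`** (`∏ sin(πj∕n) = n∕2^{n−1}`).
CAVEATS.  `n ≥ 1`; products over `j ∈ [1, n−1]` are written over `Finset.range (n − 1)` with the shift `j + 1`.  Nothing Ext-side.  New names only.
-/

open Module Polynomial
open scoped Matrix Polynomial

namespace Summit.Ventures.HSemireg.Wedge.HankelOuter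

/-! ## §1275. `C_n' = n S_{n−1}` and the sine product -/

/-- **`C_n' = n · S_{n−1}`** for all `n ∈ ℤ`, in every commutative ring (the Vieta–Lucas analogue of `T_n' = n U_{n−1}`). [Rivlin (1.97) (dilated); this file, §1275] -/
theorem chebyshevC_derivative_eq_S {R : Type*} [CommRing R] (n : ℤ) :
    derivative (Polynomial.Chebyshev.C R n) = (n : R[X]) * Polynomial.Chebyshev.S R (n - 1) := by
  induction n using Polynomial.Chebyshev.induct with
  | zero => simp
  | one => simp
  | add_two n ih1 ih2 =>
    have h₁ := congr_arg derivative (Polynomial.Chebyshev.C_add_two R n)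
    have h₂ := Polynomial.Chebyshev.S_sub_one R n
    have h₃ := Polynomial.Chebyshev.C_eq_S_sub_X_mul_S R (n + 1)
    simp only [derivative_sub, derivative_mul, derivative_X, one_mul] at h₁
    rw [add_sub_cancel_right] at h₃
    linear_combination (norm := (push_cast; ring_nf)) h₁ + (X : R[X]) * ih1 - ih2 + h₃ - n * h₂
  | neg_add_one n ih1 ih2 =>
    have h₁ := congr_arg derivative (Polynomial.Chebyshev.C_sub_one R (-n))
    have h₂ := Polynomial.Chebyshev.S_sub_two R (-n)
    have h₃ := Polynomial.Chebyshev.C_eq_S_sub_X_mul_S R (-n)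
    simp only [derivative_sub, derivative_mul, derivative_X, one_mul] at h₁
    linear_combination (norm := (push_cast; ring_nf)) h₁ + (X : R[X]) * ih1 - ih2 + h₃ + (n + 1) * h₂

/-- **`C_n'(2) = n²`** (`n ∈ ℕ`, every commutative ring; `S_{n−1}(2) = n`). [Rivlin (1.97): `T_n'(1) = n²`; this file, §1275] -/
theorem chebyshevC_derivative_eval_two {R : Type*} [CommRing R] (n : ℕ) : (derivative (Polynomial.Chebyshev.C R (n : ℤ))).eval 2 = (n : R) ^ 2 := by
  rw [chebyshevC_derivative_eq_S, eval_mul, eval_intCast, Polynomial.Chebyshev.S_eval_two, Int.cast_sub, Int.cast_natCast, Int.cast_one, sub_add_cancel, sq]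

/-- **`∏_{j=1}^{n−1} (2 − 2cos(2πj∕n)) = n²`** (`n ≥ 1`; the derivative of `C_n − 2 = (X − 2) ∏_{j=1}^{n−1} (X − 2cos(2πj∕n))` at `X = 2`). [Rivlin §1.2; Gradshteyn–Ryzhik 1.392; this file, §1275] -/
theorem prod_two_sub_two_mul_cos_eq_sq {n : ℕ} (hn : n ≠ 0) : ∏ j ∈ Finset.range (n - 1), (2 - 2 * Real.cos ((j + 1 : ℕ) * (2 * Real.pi / n))) = (n : ℝ) ^ 2 := by
  obtain ⟨m, rfl⟩ := Nat.exists_eq_add_one_of_ne_zero hn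
  rw [Nat.add_sub_cancel]
  -- `C_{m+1} − 2 = (X − 2) · Q`, `Q = ∏_{j<m} (X − 2cos(2π(j+1)/(m+1)))`
  set Q : ℝ[X] := ∏ j ∈ Finset.range m, (Polynomial.X - Polynomial.C (2 * Real.cos ((j + 1 : ℕ) * (2 * Real.pi / (m + 1 : ℕ))))) with hQ
  have hfac : Polynomial.Chebyshev.C ℝ ((m + 1 : ℕ) : ℤ) - 2 = (Polynomial.X - Polynomial.C 2) * Q := by
    rw [chebyshevC_sub_two_eq_prod_cos_real hn, Finset.prod_range_succ', Nat.cast_zero, zero_mul, Real.cos_zero, mul_one, mul_comm, hQ]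
  have hder := congrArg (fun p : ℝ[X] => (derivative p).eval 2) hfac
  simp only [derivative_sub, derivative_ofNat, sub_zero, derivative_mul, derivative_X, derivative_C, eval_add, eval_mul, eval_sub, eval_X, eval_C, sub_self, zero_mul, add_zero, one_mul,
    chebyshevC_derivative_eval_two] at hder
  rw [hder, hQ, eval_prod]
  refine Finset.prod_congr rfl fun j _ => ?_
  rw [eval_sub, eval_X, eval_C]

/-- `∏_{j=1}^{n−1} 4sin²(πj∕n) = n²` (`n ≥ 1`; `2 − 2cos 2θ = 4sin² θ`). [Gradshteyn–Ryzhik 1.392; this file, §1275] -/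
theorem prod_four_mul_sin_sq_eq_sq {n : ℕ} (hn : n ≠ 0) : ∏ j ∈ Finset.range (n - 1), 4 * Real.sin ((j + 1 : ℕ) * (Real.pi / n)) ^ 2 = (n : ℝ) ^ 2 := by
  rw [← prod_two_sub_two_mul_cos_eq_sq hn]
  refine Finset.prod_congr rfl fun j _ => ?_
  rw [show ((j + 1 : ℕ) : ℝ) * (2 * Real.pi / n) = 2 * (((j + 1 : ℕ) : ℝ) * (Real.pi / n)) by ring, Real.cos_two_mul, Real.cos_sq']
  ring

/-- **`∏_{j=1}^{n−1} 2sin(πj∕n) = n`** (`n ≥ 1`). [Gradshteyn–Ryzhik 1.392.1; this file, §1275] -/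
theorem prod_two_mul_sin_eq {n : ℕ} (hn : n ≠ 0) : ∏ j ∈ Finset.range (n - 1), 2 * Real.sin ((j + 1 : ℕ) * (Real.pi / n)) = n := by
  have hpos : ∀ j ∈ Finset.range (n - 1), 0 < 2 * Real.sin ((j + 1 : ℕ) * (Real.pi / n)) := fun j hj => by
    have hj := Finset.mem_range.mp hj
    have hnR : (0 : ℝ) < n := by exact_mod_cast Nat.pos_of_ne_zero hn
    refine mul_pos two_pos (Real.sin_pos_of_pos_of_lt_pi (by positivity) ?_)
    rw [mul_div_assoc', div_lt_iff₀ hnR]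
    have : ((j + 1 : ℕ) : ℝ) < n := by exact_mod_cast (by omega : j + 1 < n)
    nlinarith [Real.pi_pos]
  have hsq : (∏ j ∈ Finset.range (n - 1), 2 * Real.sin ((j + 1 : ℕ) * (Real.pi / n))) ^ 2 = (n : ℝ) ^ 2 := by
    rw [← Finset.prod_pow, ← prod_four_mul_sin_sq_eq_sq hn]
    refine Finset.prod_congr rfl fun j _ => ?_
    ring
  have hnn : 0 ≤ ∏ j ∈ Finset.range (n - 1), 2 * Real.sin ((j + 1 : ℕ) * (Real.pi / n)) := Finset.prod_nonneg fun j hj => (hpos j hj).le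
  nlinarith [sq_nonneg (∏ j ∈ Finset.range (n - 1), 2 * Real.sin ((j + 1 : ℕ) * (Real.pi / n)) - n), sq_nonneg (∏ j ∈ Finset.range (n - 1), 2 * Real.sin ((j + 1 : ℕ) * (Real.pi / n)) + n),
    (Nat.cast_nonneg n : (0 : ℝ) ≤ n)]

/-- **`∏_{j=1}^{n−1} sin(πj∕n) = n ∕ 2^{n−1}`** (`n ≥ 1`). [Gradshteyn–Ryzhik 1.392.1; this file, §1275] -/
theorem prod_sin_pi_div_eq {n : ℕ} (hn : n ≠ 0) : ∏ j ∈ Finset.range (n - 1), Real.sin ((j + 1 : ℕ) * (Real.pi / n)) = n / 2 ^ (n - 1) := by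
  have h := prod_two_mul_sin_eq hn
  rw [Finset.prod_mul_distrib, Finset.prod_const, Finset.card_range] at h
  rw [eq_div_iff (pow_ne_zero _ two_ne_zero), mul_comm]
  exact h

end Summit.Ventures.HSemireg.Wedge.HankelOuter
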